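import Literature.AlgebraicGeometry.AbelianSchemes.AbelianSchemeIsLambdaOfAtBaseChange
import Literature.AlgebraicGeometry.AbelianSchemes.AbelianSchemeFibreHom
import HarnessLib

/-!
# Σ-GAL ◻ H1: the fibre endomorphism of `A_{x ≫ g}` induced by an endomorphism of the base change `A ×_S S'`, read on points of `A`
# ([MumfordFogartyKirwan1994] Ch. 6 §2 Def. 6.3; [GortzWedhorn2020] Section (4.7))

Topic `AlgebraicGeometry/AbelianSchemes`, namespace `Literature.AlgebraicGeometry.AbelianSchemes.AbelianSchemeOver`.  THEOREMS ONLY (no definition, no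
named fact, no instance, no notation, no `sorry`).  Cell `hodgecm-mathlib` (D-0151), FLOOR 0, P6 «MOD» (crux hLiu418 = stmt-HodgeConjecture-24832,
`--supports`), E6 closer of `Cruxes/HLiu418/Lines/F0_P6a_PELWitnessE.lean`, socket Σ-GAL `ReadsCReading → ReadsCGalois` (A-p09 (g22) lineage, `HANDOFF-E6gamma.v1`
(G3) recipe step 3, «◻ H1: `fibreHom (Y b) x̃` moved along ★ `fibreBaseChangeIso prT x̃`; its reading `hread` is (ii) at `x`»): the binders `y` ∕ `hread` (and
`y′` ∕ `hread′` at the twisted point) of ★ G2b-α `AbelianSchemeOver.forall_point_comp_galA_of_conjugate_comp_eq`.  HC_CM is proved only modulo the printed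
citations (2 remaining named inputs hLiu418 24832, h413 24833) until rung 0 closes; this file is generic and changes no count.

THE MATHEMATICS.  `A → S` an abelian scheme, `g : S′ → S`, `Y` an endomorphism of `A♯ := A ×_S S′` which is a homomorphism of `S′`-group schemes, and
`x : Spec Ω → S′` a field-valued point.  The fibre endomorphism `Y_x : A♯_x → A♯_x` ([MumfordFogartyKirwan1994] Def. 6.3 «the induced homomorphism on
geometric fibres»; ★ `fibreHom`) moved along the canonical identification `A♯_x ≅ A_{x ≫ g}` ([GortzWedhorn2020] (4.7), ★ `fibreBaseChangeIso`) is an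
endomorphism `y` of the abelian variety `A_{x ≫ g}` which READS `Y` on points: for every `Ω`-point `q` of `A♯` over `x` whose image in `A` is the point of
`A` under `P ∈ A_{x ≫ g}(Ω)`, the image of `q ≫ Y` in `A` is the point under `y(P)`.

* §1 `fibrePointToLeft_map_fibreBaseChangeIso_hom` — the point of `A` under `e(R)` is the point of `A♯` under `R` followed by `pr_A`.
* §1 `eq_fibrePointToLeft_of_comp_snd_of_comp_fst` — a point `q` of `A♯` over `x` with prescribed image in `A` IS the section `e⁻¹(P)` of `A♯_x`.
* §2 **`exists_fibre_hom_reads_baseChange_endomorphism`** — THE HEAD (`y := e⁻¹ ≫ Y_x ≫ e` with the reading `hread` of ★ G2b-α, token for token).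

## References
* [MumfordFogartyKirwan1994] D. Mumford, J. Fogarty, F. Kirwan, *Geometric Invariant Theory*, 3rd ed. (1994), Ch. 6 §2 Definition 6.3 (p. 120), §1
  Definition 6.1 (p. 115).
* [GortzWedhorn2020] U. Görtz, T. Wedhorn, *Algebraic Geometry I* (2nd ed. 2020), Section (4.7) (pp. 107–108, p. 135), Prop. 4.16.
-/

set_option autoImplicit false

noncomputable section

universe u

open CategoryTheory CategoryTheory.Limits AlgebraicGeometry
open Literature.AlgebraicGeometry.Motives (AlgPoints AbelianVariety)

namespace Literature.AlgebraicGeometry.AbelianSchemes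

namespace AbelianSchemeOver

variable {S S' : Scheme.{u}} (A : AbelianSchemeOver S) (g : S' ⟶ S) {Ω : Type u} [Field Ω] (x : Spec (.of Ω) ⟶ S')

/-! ### §1 Points of `A♯_x` versus points of `A_{x ≫ g}` -/

/-- **The point of `A` under `e(R)`, `e : A♯_x ≅ A_{x ≫ g}`, is the point of `A♯ = A ×_S S′` under `R` followed by the projection to `A`.**
[cite: GortzWedhorn2020, Section (4.7) (p. 135)] -/
theorem fibrePointToLeft_map_fibreBaseChangeIso_hom (R : ((A.baseChange g).fibre x).toAbelianVariety.Points Ω) :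
    A.fibrePointToLeft (x ≫ g) (AlgPoints.map (A.fibreBaseChangeIso g x).hom.hom.hom.hom R) =
      (A.baseChange g).fibrePointToLeft x R ≫ pullback.fst A.X.hom g := by
  change (AlgPoints.map (A.fibreBaseChangeIso g x).hom.hom.hom.hom R).left ≫ pullback.fst A.X.hom (x ≫ g) =
    (R.left ≫ pullback.fst (pullback.snd A.X.hom g) x) ≫ pullback.fst A.X.hom g
  rw [A.map_fibreBaseChangeIso_left g x R, Category.assoc, A.fibreBaseChangeIso_hom_toSchemeHom_fst g x, Category.assoc]
  rfl

/-- **An `Ω`-point `q` of `A♯` over `x` whose image in `A` is the point under `P ∈ A_{x ≫ g}(Ω)` IS the section `e⁻¹(P)` of the fibre `A♯_x`**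
(both lie over `x` and over the same point of `A`; `A♯ = A ×_S S′` is a fibre product). [cite: GortzWedhorn2020, Section (4.7) (pp. 107–108) and Prop. 4.16] -/
theorem eq_fibrePointToLeft_of_comp_snd_of_comp_fst (q : Spec (.of Ω) ⟶ pullback A.X.hom g) (P : (A.fibre (x ≫ g)).toAbelianVariety.Points Ω)
    (hq : q ≫ pullback.snd A.X.hom g = x) (hP : q ≫ pullback.fst A.X.hom g = A.fibrePointToLeft (x ≫ g) P) :
    q = (A.baseChange g).fibrePointToLeft x (AlgPoints.map (A.fibreBaseChangeIso g x).inv.hom.hom.hom P) := by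
  set R := AlgPoints.map (A.fibreBaseChangeIso g x).inv.hom.hom.hom P with hR
  have hPR : AlgPoints.map (A.fibreBaseChangeIso g x).hom.hom.hom.hom R = P := by
    rw [hR, ← AlgPoints.map_comp_apply]
    change AlgPoints.map ((A.fibreBaseChangeIso g x).inv ≫ (A.fibreBaseChangeIso g x).hom).hom.hom.hom P = P
    rw [Iso.inv_hom_id]
    rfl
  apply pullback.hom_ext
  · -- same point of `A`
    rw [hP, ← hPR, A.fibrePointToLeft_map_fibreBaseChangeIso_hom g x R]
    rfl
  · -- same point of `S′`
    rw [hq]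
    exact ((A.baseChange g).fibrePointToLeft_comp_hom x R).symm

/-! ### §2 The head -/

/-- **Σ-GAL ◻ H1 — THE FIBRE ENDOMORPHISM OF `A_{x ≫ g}` INDUCED BY AN ENDOMORPHISM OF `A ×_S S′`, WITH ITS READING.**  For a homomorphism
`Y : A♯ ⟶ A♯` of the base change `A♯ = A ×_S S′` and a field point `x` of `S′`, there is an endomorphism `y` of the abelian variety `A_{x ≫ g}`
(`y := e⁻¹ ≫ Y_x ≫ e`, `Y_x` the fibre homomorphism ★ `fibreHom Y x`, `e` ★ `fibreBaseChangeIso g x`) such that for every `Ω`-point `q` of `A♯` over `x`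
and every `P ∈ A_{x ≫ g}(Ω)` with `q ≫ pr_A =` the point of `A` under `P`, `(q ≫ Y) ≫ pr_A =` the point of `A` under `y(P)` — VERBATIM the binders
`y`∕`hread` of ★ G2b-α `forall_point_comp_galA_of_conjugate_comp_eq` (there `A := P.A`, `g := prT`, `Y := Y b`, `x := x̃`; and `y′`∕`hread′` at the twisted
point `specAut σ ≫ x̃ ≫ gal σ`). [cite: MumfordFogartyKirwan1994, Ch. 6 §2 Definition 6.3 (p. 120)] [cite: GortzWedhorn2020, Section (4.7) (p. 135)] -/
theorem exists_fibre_hom_reads_baseChange_endomorphism (Y : (A.baseChange g).X ⟶ (A.baseChange g).X) [IsMonHom Y] :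
    ∃ y : (A.fibre (x ≫ g)).toAbelianVariety ⟶ (A.fibre (x ≫ g)).toAbelianVariety,
      ∀ (q : Spec (.of Ω) ⟶ pullback A.X.hom g) (P : (A.fibre (x ≫ g)).toAbelianVariety.Points Ω),
        q ≫ pullback.snd A.X.hom g = x →
        q ≫ pullback.fst A.X.hom g = A.fibrePointToLeft (x ≫ g) P →
          (q ≫ Y.left) ≫ pullback.fst A.X.hom g =
            A.fibrePointToLeft (x ≫ g) (AlgPoints.map y.hom.hom.hom P) := by
  refine ⟨(A.fibreBaseChangeIso g x).inv ≫ fibreHom Y x ≫ (A.fibreBaseChangeIso g x).hom, fun q P hq hP => ?_⟩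
  -- `q` is the section `e⁻¹(P)` of `A♯_x`
  set R := AlgPoints.map (A.fibreBaseChangeIso g x).inv.hom.hom.hom P with hR
  have hqR : q = (A.baseChange g).fibrePointToLeft x R := A.eq_fibrePointToLeft_of_comp_snd_of_comp_fst g x q P hq hP
  -- `y(P) = e (Y_x (e⁻¹ P))`
  have hy : AlgPoints.map ((A.fibreBaseChangeIso g x).inv ≫ fibreHom Y x ≫ (A.fibreBaseChangeIso g x).hom).hom.hom.hom P =
      AlgPoints.map (A.fibreBaseChangeIso g x).hom.hom.hom.hom (AlgPoints.map (fibreHom Y x).hom.hom.hom R) := by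
    change AlgPoints.map ((A.fibreBaseChangeIso g x).inv.hom.hom.hom ≫ (fibreHom Y x).hom.hom.hom ≫
      (A.fibreBaseChangeIso g x).hom.hom.hom.hom) P = _
    rw [AlgPoints.map_comp_apply, AlgPoints.map_comp_apply]
  rw [hy, A.fibrePointToLeft_map_fibreBaseChangeIso_hom g x, fibrePointToLeft_map_fibreHom Y x R, hqR]
  simp only [Category.assoc]
  rfl

/-! ### §3 (ED. 2) The same at a prescribed base point `s = x ≫ g` (the twisted point of Σ-GAL) -/

/-- **ED. 2 — the head with the fibre named by any `s` with `x ≫ g = s`** (so the endomorphism lives on `A_s` for the syntactic `s` the consumer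
holds: in Σ-GAL the twisted honest point `x′ := specAut σ ≫ x̃ ≫ gal σ` has `x′ ≫ prT = specTwist σ ≫ x̃ ≫ prT` only propositionally, by ★ `gal_fst`,
and ★ G2b-α wants `y′` on `A_{specTwist σ ≫ x̃ ≫ prT}`).  Proof: `subst`. [cite: MumfordFogartyKirwan1994, Ch. 6 §2 Definition 6.3 (p. 120)]
[cite: GortzWedhorn2020, Section (4.7) (p. 135)] -/
theorem exists_fibre_hom_reads_baseChange_endomorphism_of_comp_eq (Y : (A.baseChange g).X ⟶ (A.baseChange g).X) [IsMonHom Y]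
    (s : Spec (.of Ω) ⟶ S) (hxs : x ≫ g = s) :
    ∃ y : (A.fibre s).toAbelianVariety ⟶ (A.fibre s).toAbelianVariety,
      ∀ (q : Spec (.of Ω) ⟶ pullback A.X.hom g) (P : (A.fibre s).toAbelianVariety.Points Ω),
        q ≫ pullback.snd A.X.hom g = x →
        q ≫ pullback.fst A.X.hom g = A.fibrePointToLeft s P →
          (q ≫ Y.left) ≫ pullback.fst A.X.hom g = A.fibrePointToLeft s (AlgPoints.map y.hom.hom.hom P) := by
  subst hxs
  exact A.exists_fibre_hom_reads_baseChange_endomorphism g x Y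

end AbelianSchemeOver

end Literature.AlgebraicGeometry.AbelianSchemes

end
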